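import Summits.FinalStateConjecture.FinalStateConjecture.Theses.GlobalAttraction

/-!
# Line `neck-split` for the crux `GlobalAttraction.CensoredExteriorsSettle` (stmt-FinalStateConjecture-17296)
# — the BC2 REDIRECT itself as a registered skeleton: fixed-radius censored settling ∧ neck completion ⇒ C2

Crux-strategist r1 (unit `cstrat-stmt-FinalStateConjecture-17296-r1`, 2026-08-17).  The deciding crux C2 of route
GlobalAttraction was re-audited RESTATED (at least summit-hard as ONE statement).  This skeleton is the typed
decomposition that redirects it, with the two pieces as the registered stubs and the assembly PROVED:

* `stub_censoredFixedRadiusSettle` = X₁ `CensoredFixedRadiusSettle` (route child, crux): censorship ⇒ an honest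
  `C⁰` decomposition at every FIXED radius — `O = exteriorOf`, `RaysStayInClosure`, `IsFutureOriented`, and the
  fixed-scale honesty bundles `Hc⁰ ∧ Hf` (the HonestCore/HonestFar clause lists of `StarvedNecks.HonestFixedRadiusSettlingT`,
  stmt-FinalStateConjecture-17575, with the sub-extremality conjunct removed) — but NO `HasExhaustiveCharts`.
  Komech's global attraction in its native LOCAL-seminorm form (book:komech2021 Ch. VI), all censored data.
* `stub_fixedRadiusNecksComplete` = X₂ `FixedRadiusNecksComplete` (route child, crux): every such fixed-scale honest
  decomposition `d` completes across its necks to a `C⁰` decomposition `d₂` of the SAME `O` extending `d` (tie on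
  `{rᵢ ≤ R₀}`, same holes / masses / spins / motions) with `C⁰` certification out to radii `Rᵢ ≥ R₀' + 4 ≥ 100 Mᵢ + 4`
  and the causal covering `O ∖ certifiedLate ⊆ J⁻(certifiedSlab)` at every `τ₁ > τ₀(d₂)`; radii need not grow; no
  coordinate-tube bookkeeping (the S8/S12 clauses refuted for comoving pairs by
  `Theorems/NecksCertify/Negative/NecksCertifyFalseOfEqualVelocityBinaryWitness.lean` are absent).
* `CensoredExteriorsSettle_of : X₁ → X₂ → GlobalAttraction.CensoredExteriorsSettle` — PROVED, placeholder-free: X₂ completes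
  X₁'s `d` on the same `O` (`RaysStayInClosure` inherited), and the honest GROWING radii of `HasExhaustiveCharts d₂`
  are manufactured from X₂'s non-growing ones by `hasExhaustiveCharts_of_covering₀` — `R'ᵢ := max Rᵢ Rgᵢ` with
  `Rgᵢ → ∞` the DIAGONAL RADII (`exists_diagonalRadii`, the diagonal argument of StarvedNecks' support `DiagonalRadii`,
  stmt-FinalStateConjecture-13552, re-proved inline) of the structure's own fixed-radius convergence; the truncated
  deviation at a `max` of radii is the `max` of the deviations, `certifiedLate` / `certifiedSlab` / `J⁻` are monotone
  in the radii, `max (r₊, 0) + 1 ≤ 2 Mᵢ + 1 ≤ R₀' + 4 ≤ Rᵢ ≤ R'ᵢ`.  ~160 lines of real content, not a connective seam.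

The Theses-free, Theorems-ready copy of the same assembly (hypotheses and conclusion spelled out verbatim, for a
prover to land as `Theorems/GlobalAttractionCensoredExteriorsSettleSplit.lean --supports stmt-FinalStateConjecture-17296`
and for the split's glue item) is `Cruxes/CensoredExteriorsSettle/NeckSplitAssembly.lean`.  BC2 (c) probes
(`Xᵢ → FinalStateConjecture`, `Xᵢ → C2` by `exact?` / `simpa` / `aesop`, and the stubs of each piece's birth skeleton
against the piece and the summit) all FAIL (session folder `bc/`, rc 1 ×6 files).  Disproof used: none exists for this
crux (`Cruxes/CensoredExteriorsSettle/` had no workfiles); negatives index: 1 entry (UniformPhotonSphereChannels),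
unrelated.  Sources: Komech2021 Ch. VI; arXiv:2104.08222 §1; ONeill1983 Ch. 14 p. 403.
-/

noncomputable section

set_option linter.dupNamespace false

open Set Filter Topology
open scoped ENNReal Topology Manifold ContDiff
open Literature.Geometry.Lorentzian

namespace Summit.FinalStateConjecture.FinalStateConjecture.Cruxes.CensoredExteriorsSettle.NeckSplit

/-! ### The two registered stubs (the pieces X₁, X₂ of the redirect, verbatim the route children's texts) -/

/-- **Stub X₁ `CensoredFixedRadiusSettle`** (route child, crux, rank 2): censorship ⇒ honest fixed-radius `C⁰`
settling, all data (Komech-type LOCAL attraction; no `HasExhaustiveCharts`).  Open-problem sized. -/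
theorem stub_censoredFixedRadiusSettle : open Literature.Geometry.Lorentzian in open scoped ContDiff ENNReal Manifold Topology in let Hc := (fun (𝓢 : Spacetime.{0} 4) (O : Set 𝓢.carrier) (k : ℕ) (d : FinalStateDecomposition 𝓢 O k) (R₀ : ℝ) => let B := d.background; let t := fun i ↦ (B i).time; let r := fun i ↦ (B i).radius; let Ψ := d.chart; (∀ i, 100 * d.mass i ≤ R₀ ∧ 0 < ((d.motion i).1 : E4 ≃L[ℝ] E4) (E4.basisVector 0) 0) ∧ (∀ i (ϱ τ₂ : ℝ), R₀ ≤ ϱ → d.τ₀ < τ₂ → Ψ i '' {x | d.τ₀ < t i x.1 ∧ t i x.1 < τ₂ ∧ r i x.1 < ϱ} ⊆ 𝓢.metric.causalPast 𝓢.timeOrientation (Ψ i '' (B i).truncTimeSlab ϱ τ₂)) ∧ (∀ i (τ' : ℝ) (ϱ : ℝ → ℝ), Continuous ϱ → d.τ₀ < τ' → let A := Ψ i '' {x | τ' ≤ t i x.1 ∧ r i x.1 ≤ ϱ (t i x.1)}; closure A ∩ O ⊆ A) ∧ (∀ y : d.flatDomain, d.τ₀ < y.1 0 → 𝓢.timeOrientation.IsFutureDirected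 (mfderiv 𝓘(ℝ, E4) (𝓡 4) d.flatChart y (E4.basisVector 0)))); let Hf := (fun (𝓢 : Spacetime.{0} 4) (O : Set 𝓢.carrier) (k : ℕ) (d : FinalStateDecomposition 𝓢 O k) (R₀ : ℝ) => let B := d.background; let t := fun i ↦ (B i).time; let r := fun i ↦ (B i).radius; let Φ := d.flatChart; (∀ τ₂ : ℝ, d.τ₀ < τ₂ → Φ '' {y | d.τ₀ < y.1 0 ∧ y.1 0 < τ₂} ⊆ 𝓢.metric.causalPast 𝓢.timeOrientation (Φ '' (Minkowski.backgroundOn d.flatDomain).timeSlab τ₂)) ∧ (∀ τ' : ℝ, d.τ₀ < τ' → closure (Φ '' {y | τ' ≤ y.1 0 ∧ ∀ i, d.excision i (y.1 0) + 1 ≤ r i y.1}) ⊆ Φ '' {y | τ' ≤ y.1 0}) ∧ (∀ i, ∃ T : ℝ, supCkENorm (Subtype.val '' {x : (B i).domain | T ≤ t i x.1 ∧ R₀ ≤ r i x.1 ∧ ∀ j, j ≠ i → r i x.1 ≤ r j x.1}) 0 (𝓢.deviationExtend (B i) (d.chart i)) ≤ ENNReal.ofReal (1 / (10 * ‖(((d.motion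 i).1 : E4 ≃L[ℝ] E4) : E4 →L[ℝ] E4)‖ ^ 2)))); ∀ (X : Type) [TopologicalSpace X] [ChartedSpace E3 X] [IsManifold (𝓡 3) ((⊤ : ℕ∞) : WithTop ℕ∞) X] [T2Space X] [SecondCountableTopology X] [ConnectedSpace X], ∀ D ∈ admissibleVacuumData X, ∀ 𝒟 : VacuumCauchyDevelopment D, 𝒟.IsMaximal → Summit.FinalStateConjecture.HasCompleteNullInfinity 𝒟.toCauchyDevelopment → ∃ (O : Set 𝒟.carrier) (d : FinalStateDecomposition 𝒟.toSpacetime O 0) (R₀ : ℝ), O = Summit.FinalStateConjecture.exteriorOf 𝒟.toCauchyDevelopment d.charted ∧ Summit.FinalStateConjecture.RaysStayInClosure 𝒟.toCauchyDevelopment O ∧ Summit.FinalStateConjecture.IsFutureOriented d ∧ Hc 𝒟.toSpacetime O 0 d R₀ ∧ Hf 𝒟.toSpacetime O 0 d R₀ := by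
  sorry

/-- **Stub X₂ `FixedRadiusNecksComplete`** (route child, crux, rank 3): every fixed-scale honest `C⁰`
decomposition of a censored MGHD completes across its necks (certification + covering at radii `≥ R₀' + 4`,
extending the input; radii need not grow).  XL. -/
theorem stub_fixedRadiusNecksComplete : open Literature.Geometry.Lorentzian in open scoped ContDiff ENNReal Manifold Topology in let Hc := (fun (𝓢 : Spacetime.{0} 4) (O : Set 𝓢.carrier) (k : ℕ) (d : FinalStateDecomposition 𝓢 O k) (R₀ : ℝ) => let B := d.background; let t := fun i ↦ (B i).time; let r := fun i ↦ (B i).radius; let Ψ := d.chart; (∀ i, 100 * d.mass i ≤ R₀ ∧ 0 < ((d.motion i).1 : E4 ≃L[ℝ] E4) (E4.basisVector 0) 0) ∧ (∀ i (ϱ τ₂ : ℝ), R₀ ≤ ϱ → d.τ₀ < τ₂ → Ψ i '' {x | d.τ₀ < t i x.1 ∧ t i x.1 < τ₂ ∧ r i x.1 < ϱ} ⊆ 𝓢.metric.causalPast 𝓢.timeOrientation (Ψ i '' (B i).truncTimeSlab ϱ τ₂)) ∧ (∀ i (τ' : ℝ) (ϱ : ℝ → ℝ), Continuous ϱ → d.τ₀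 < τ' → let A := Ψ i '' {x | τ' ≤ t i x.1 ∧ r i x.1 ≤ ϱ (t i x.1)}; closure A ∩ O ⊆ A) ∧ (∀ y : d.flatDomain, d.τ₀ < y.1 0 → 𝓢.timeOrientation.IsFutureDirected (mfderiv 𝓘(ℝ, E4) (𝓡 4) d.flatChart y (E4.basisVector 0)))); let Hf := (fun (𝓢 : Spacetime.{0} 4) (O : Set 𝓢.carrier) (k : ℕ) (d : FinalStateDecomposition 𝓢 O k) (R₀ : ℝ) => let B := d.background; let t := fun i ↦ (B i).time; let r := fun i ↦ (B i).radius; let Φ := d.flatChart; (∀ τ₂ : ℝ, d.τ₀ < τ₂ → Φ '' {y | d.τ₀ < y.1 0 ∧ y.1 0 < τ₂} ⊆ 𝓢.metric.causalPast 𝓢.timeOrientation (Φ '' (Minkowski.backgroundOn d.flatDomain).timeSlab τ₂)) ∧ (∀ τ' : ℝ, d.τ₀ < τ' → closure (Φ '' {y | τ' ≤ y.1 0 ∧ ∀ i, d.excision i (y.1 0) + 1 ≤ r i y.1}) ⊆ Φ '' {y | τ' ≤ y.1 0}) ∧ (∀ i, ∃ T : ℝ, supCkENorm (Subtype.val ''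 {x : (B i).domain | T ≤ t i x.1 ∧ R₀ ≤ r i x.1 ∧ ∀ j, j ≠ i → r i x.1 ≤ r j x.1}) 0 (𝓢.deviationExtend (B i) (d.chart i)) ≤ ENNReal.ofReal (1 / (10 * ‖(((d.motion i).1 : E4 ≃L[ℝ] E4) : E4 →L[ℝ] E4)‖ ^ 2)))); let Tie := (fun (𝓢 : Spacetime.{0} 4) (O : Set 𝓢.carrier) (d d₂ : FinalStateDecomposition 𝓢 O 0) (R₀ : ℝ) => ∃ e : d.N = d₂.N, ∀ i : Fin d.N, d₂.mass (Fin.cast e i) = d.mass i ∧ d₂.spin (Fin.cast e i) = d.spin i ∧ d₂.motion (Fin.cast e i) = d.motion i ∧ ∀ x : (d.background i).domain, d₂.τ₀ < (d.background i).time x.1 → (d.background i).radius x.1 ≤ R₀ → ∃ y : (d₂.background (Fin.cast e i)).domain, y.1 = x.1 ∧ d₂.chart (Fin.cast e i) y = d.chart i x); ∀ (X : Type) [TopologicalSpace X] [ChartedSpace E3 X] [IsManifold (𝓡 3) ((⊤ : ℕ∞) : WithTop ℕ∞) X] [T2Space X] [SecondCountableTopology X] [ConnectedSpace X], ∀ D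 ∈ admissibleVacuumData X, ∀ 𝒟 : VacuumCauchyDevelopment D, 𝒟.IsMaximal → Summit.FinalStateConjecture.HasCompleteNullInfinity 𝒟.toCauchyDevelopment → ∀ (O : Set 𝒟.carrier) (d : FinalStateDecomposition 𝒟.toSpacetime O 0) (R₀ : ℝ), O = Summit.FinalStateConjecture.exteriorOf 𝒟.toCauchyDevelopment d.charted → Summit.FinalStateConjecture.RaysStayInClosure 𝒟.toCauchyDevelopment O → Summit.FinalStateConjecture.IsFutureOriented d → Hc 𝒟.toSpacetime O 0 d R₀ → Hf 𝒟.toSpacetime O 0 d R₀ → ∃ (d₂ : FinalStateDecomposition 𝒟.toSpacetime O 0) (R : Fin d₂.N → ℝ → ℝ) (R₀' : ℝ), O = Summit.FinalStateConjecture.exteriorOf 𝒟.toCauchyDevelopment d₂.charted ∧ Summit.FinalStateConjecture.IsFutureOriented d₂ ∧ R₀ ≤ R₀' ∧ (∀ i, 100 * d₂.mass i ≤ R₀') ∧ (∀ i s, R₀' + 4 ≤ R i s) ∧ (∀ i, Filter.Tendsto (fun τ ↦ 𝒟.toSpacetime.truncDeviationCk (d₂.background i) (d₂.chart i) 0 (R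 i τ) τ) Filter.atTop (nhds 0)) ∧ (∀ τ₁ : ℝ, d₂.τ₀ < τ₁ → O \ Summit.FinalStateConjecture.certifiedLate d₂ R τ₁ ⊆ 𝒟.toSpacetime.metric.causalPast 𝒟.toSpacetime.timeOrientation (Summit.FinalStateConjecture.certifiedSlab d₂ R τ₁)) ∧ Tie 𝒟.toSpacetime O d d₂ R₀ := by
  sorry

/-! ### Diagonal radii (the diagonal argument of route StarvedNecks' `DiagonalRadii`, re-proved `Theses`-free) -/

/-- The clipped ramp `x ↦ min c (max 0 (x - s))` is `1`-Lipschitz in the additive form used by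
`LipschitzWith.of_le_add`. [folklore] -/
theorem clippedRamp_le_add_dist (c s x y : ℝ) :
    min c (max 0 (x - s)) ≤ min c (max 0 (y - s)) + dist x y := by
  have hd : x - y ≤ dist x y := by
    rw [Real.dist_eq]
    exact le_abs_self _
  have h0 : (0 : ℝ) ≤ dist x y := dist_nonneg
  have h1 : max 0 (x - s) ≤ max 0 (y - s) + dist x y :=
    max_le (add_nonneg (le_max_left _ _) h0) (by linarith [le_max_right 0 (y - s)])
  calc min c (max 0 (x - s)) ≤ min c (max 0 (y - s) + dist x y) := min_le_min_left _ h1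
    _ ≤ min c (max 0 (y - s)) + dist x y := by
        rcases le_total c (max 0 (y - s)) with h | h
        · rw [min_eq_left h]
          exact (min_le_left _ _).trans (le_add_of_nonneg_right h0)
        · rw [min_eq_right h]
          exact min_le_right _ _

/-- **Slow ramp.** For monotone thresholds `t : ℕ → ℝ` there is a monotone continuous `R : ℝ → ℝ` with
`n ≤ R τ` once `t (n + 1) + n ≤ τ` and `R τ ≤ m` while `τ < t (m + 1)`; witness
`R τ = ⨆ n, min n (max 0 (τ - t (n + 1)))`. [folklore] -/
theorem exists_slow_ramp (t : ℕ → ℝ) (ht : Monotone t) :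
    ∃ R : ℝ → ℝ, Monotone R ∧ Continuous R ∧
      (∀ (n : ℕ) (τ : ℝ), t (n + 1) + n ≤ τ → (n : ℝ) ≤ R τ) ∧
      (∀ (m : ℕ) (τ : ℝ), τ < t (m + 1) → R τ ≤ m) := by
  have hbdd : ∀ τ : ℝ, BddAbove (range fun n : ℕ => min (n : ℝ) (max 0 (τ - t (n + 1)))) := by
    intro τ
    refine ⟨max 0 (τ - t 0), ?_⟩
    rintro _ ⟨n, rfl⟩
    have h0n : t 0 ≤ t (n + 1) := ht (Nat.zero_le _)
    exact min_le_of_right_le (max_le_max le_rfl (by linarith))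
  refine ⟨fun τ => ⨆ n : ℕ, min (n : ℝ) (max 0 (τ - t (n + 1))), ?_, ?_, ?_, ?_⟩
  · intro x y hxy
    exact ciSup_le fun n =>
      le_trans (min_le_min_left _ (max_le_max_left _ (sub_le_sub_right hxy _)))
        (le_ciSup (hbdd y) n)
  · refine (LipschitzWith.of_le_add fun x y => ?_).continuous
    exact ciSup_le fun n =>
      (clippedRamp_le_add_dist (n : ℝ) (t (n + 1)) x y).trans
        (add_le_add (le_ciSup (hbdd y) n) le_rfl)
  · intro n τ hτ
    refine le_trans ?_ (le_ciSup (hbdd τ) n)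
    exact le_min le_rfl (le_max_of_le_right (by linarith))
  · intro m τ hτ
    refine ciSup_le fun n => ?_
    rcases le_or_gt n m with hnm | hmn
    · exact min_le_of_left_le (by exact_mod_cast hnm)
    · have h1 : t (m + 1) ≤ t (n + 1) := ht (by omega)
      have h2 : max 0 (τ - t (n + 1)) = 0 := max_eq_left (by linarith)
      rw [h2]
      exact min_le_of_right_le (Nat.cast_nonneg m)

/-- **Diagonal radii.** If `a : ℝ → ℝ → ℝ≥0∞` is monotone in the radius `ρ` and `a ρ τ → 0` as `τ → ∞`
for every fixed `ρ`, then some monotone continuous `Rg → ∞` has `a (Rg τ) τ → 0` (thresholds `T k` with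
`a k τ ≤ k⁻¹` for `τ ≥ T k`, monotone `t k := partialSups T k + k`, the slow ramp, and `a (Rg τ) τ ≤ a m τ ≤ m⁻¹`
for `t m ≤ τ < t (m + 1)`).  Verbatim the landed `DiagonalRadii.diagonalRadii_proof` (route StarvedNecks, item
stmt-FinalStateConjecture-13552) with its statement spelled out. [folklore] -/
theorem exists_diagonalRadii (a : ℝ → ℝ → ℝ≥0∞) (hmono : ∀ τ, Monotone (fun ρ ↦ a ρ τ))
    (hlim : ∀ ρ, Tendsto (fun τ ↦ a ρ τ) atTop (𝓝 0)) :
    ∃ Rg : ℝ → ℝ, Monotone Rg ∧ Continuous Rg ∧ Tendsto Rg atTop atTop ∧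
      Tendsto (fun τ ↦ a (Rg τ) τ) atTop (𝓝 0) := by
  have hT : ∀ k : ℕ, ∃ T : ℝ, ∀ τ ≥ T, a k τ ≤ (k : ℝ≥0∞)⁻¹ := fun k =>
    ENNReal.tendsto_atTop_zero.1 (hlim k) _ (ENNReal.inv_pos.2 (ENNReal.natCast_ne_top k))
  choose T hT using hT
  obtain ⟨t, ht_mono, hTt, ht_ge⟩ : ∃ t : ℕ → ℝ, Monotone t ∧ (∀ k, T k ≤ t k) ∧
      (∀ k : ℕ, T 0 + k ≤ t k) := by
    refine ⟨fun k => partialSups T k + k, ?_, ?_, ?_⟩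
    · intro i j hij
      exact add_le_add ((partialSups T).monotone hij) (by exact_mod_cast hij)
    · intro k
      have h1 : T k ≤ partialSups T k := le_partialSups T k
      have h2 : (0 : ℝ) ≤ k := Nat.cast_nonneg k
      change T k ≤ partialSups T k + k
      linarith
    · intro k
      have h1 : T 0 ≤ partialSups T k := le_partialSups_of_le T (Nat.zero_le k)
      change T 0 + (k : ℝ) ≤ partialSups T k + k
      linarith
  have ht_top : Tendsto t atTop atTop :=
    tendsto_atTop_mono ht_ge (tendsto_atTop_add_const_left atTop (T 0) tendsto_natCast_atTop_atTop)
  obtain ⟨R, hRmono, hRcont, hRlow, hRup⟩ := exists_slow_ramp t ht_mono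
  refine ⟨R, hRmono, hRcont, ?_, ?_⟩
  · refine tendsto_atTop_atTop.2 fun b => ⟨t (⌈b⌉₊ + 1) + ⌈b⌉₊, fun τ hτ => ?_⟩
    exact (Nat.le_ceil b).trans (hRlow _ _ hτ)
  · rw [ENNReal.tendsto_nhds_zero]
    intro ε hε
    obtain ⟨M, hM⟩ := ENNReal.exists_inv_nat_lt hε.ne'
    filter_upwards [eventually_ge_atTop (t (M + 1))] with τ hτ
    have hex : ∃ n, τ < t n := (ht_top.eventually (eventually_gt_atTop τ)).exists
    classical
    have hn₀ : τ < t (Nat.find hex) := Nat.find_spec hex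
    have hMn₀ : M + 1 < Nat.find hex := by
      by_contra h
      exact absurd (hn₀.trans_le (ht_mono (not_lt.1 h))) (not_lt.2 hτ)
    obtain ⟨m, hm⟩ : ∃ m, Nat.find hex = m + 1 := ⟨Nat.find hex - 1, by omega⟩
    have htm : t m ≤ τ := not_lt.1 (Nat.find_min hex (show m < Nat.find hex by omega))
    have hMm : M ≤ m := by omega
    rw [hm] at hn₀
    calc a (R τ) τ ≤ a m τ := hmono τ (hRup m τ hn₀)
      _ ≤ (m : ℝ≥0∞)⁻¹ := hT m τ ((hTt m).trans htm)
      _ ≤ (M : ℝ≥0∞)⁻¹ := ENNReal.inv_le_inv.2 (by exact_mod_cast hMm)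
      _ ≤ ε := hM.le

/-! ### Honest growing radii from non-growing ones (`k = 0`) -/

/-- `r₊ ≤ 2M` for `0 ≤ M` (`√(M² − a²) ≤ M`). O'Neill 1995, Ch. 2, §2.3. [folklore] -/
theorem rPlus_le_two_mul₀ {M a : ℝ} (hM : 0 ≤ M) : Kerr.rPlus M a ≤ 2 * M := by
  unfold Kerr.rPlus
  have : √(M ^ 2 - a ^ 2) ≤ M := by
    rw [Real.sqrt_le_left hM]
    nlinarith [sq_nonneg a]
  linarith

/-- **Honest growing radii from non-growing ones (`k = 0`).**  If radii `R ≥ R₀ + 4` with `100 Mᵢ ≤ R₀` carry the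
`C⁰` certification (clause (i)) and the covering clause (ii) of `HasExhaustiveCharts`, then `HasExhaustiveCharts d`
holds, witnessed by `R'ᵢ τ := max (Rᵢ τ) (Rgᵢ τ)` with `Rgᵢ → ∞` the diagonal radii of the STRUCTURE's own
fixed-radius convergence (monotone in the radius, `truncDeviationCk_mono`): the truncated deviation at the `max`
of two radii is the `max` of the two deviations; `certifiedLate`, `certifiedSlab` and `J⁻` are monotone in the
radii; `max (r₊, 0) + 1 ≤ 2 Mᵢ + 1 ≤ R₀ + 4 ≤ Rᵢ ≤ R'ᵢ`.  The `k = 0` analogue of route StarvedNecks'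
`SeamedChartsExhaust.HonestRadii.hasExhaustiveCharts_of_covering`. DHRT arXiv:2104.08222, §1; O'Neill 1983,
Ch. 14, p. 403. [folklore] -/
theorem hasExhaustiveCharts_of_covering₀ {𝓢 : Spacetime.{0} 4} {O : Set 𝓢.carrier}
    (d : FinalStateDecomposition 𝓢 O 0) (R : Fin d.N → ℝ → ℝ) (R₀ : ℝ)
    (hR₀ : ∀ i, 100 * d.mass i ≤ R₀) (hR : ∀ i s, R₀ + 4 ≤ R i s)
    (hcert : ∀ i, Tendsto (fun τ ↦ 𝓢.truncDeviationCk (d.background i) (d.chart i) 0 (R i τ) τ)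
      atTop (𝓝 0))
    (hcov : ∀ τ₁ : ℝ, d.τ₀ < τ₁ →
      O \ certifiedLate d R τ₁ ⊆ 𝓢.metric.causalPast 𝓢.timeOrientation (certifiedSlab d R τ₁)) :
    HasExhaustiveCharts d := by
  have hmono : ∀ i τ, Monotone (fun ρ ↦ 𝓢.truncDeviationCk (d.background i) (d.chart i) 0 ρ τ) :=
    fun i τ ρ ρ' h ↦ 𝓢.truncDeviationCk_mono (d.background i) (d.chart i) 0 h τ
  have hRg : ∀ i, ∃ Rg : ℝ → ℝ, Tendsto Rg atTop atTop ∧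
      Tendsto (fun τ ↦ 𝓢.truncDeviationCk (d.background i) (d.chart i) 0 (Rg τ) τ) atTop (𝓝 0) := by
    intro i
    obtain ⟨Rg, -, -, htop, hlim⟩ :=
      exists_diagonalRadii (fun ρ τ ↦ 𝓢.truncDeviationCk (d.background i) (d.chart i) 0 ρ τ) (hmono i)
        (d.tendsto_truncDeviationCk i)
    exact ⟨Rg, htop, hlim⟩
  choose Rg hRg_top hRg_lim using hRg
  have hle : ∀ i τ, R i τ ≤ max (R i τ) (Rg i τ) := fun i τ ↦ le_max_left _ _
  refine ⟨fun i τ ↦ max (R i τ) (Rg i τ), fun i ↦ ⟨?_, fun τ ↦ ?_⟩, fun i ↦ ?_, fun τ₁ hτ₁ ↦ ?_⟩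
  · -- the enlarged radii grow: `R' ≥ Rg → ∞`
    exact tendsto_atTop_mono (fun τ ↦ le_max_right _ _) (hRg_top i)
  · -- honest: `max (r₊, 0) + 1 ≤ 2M + 1 ≤ R₀ + 4 ≤ R ≤ R'`
    have hM : 0 < d.mass i := d.mass_pos i
    have h2M : Kerr.rPlus (d.mass i) (d.spin i) ≤ 2 * d.mass i := rPlus_le_two_mul₀ hM.le
    have hmax : max (Kerr.rPlus (d.mass i) (d.spin i)) 0 ≤ 2 * d.mass i := max_le h2M (by linarith)
    calc max (Kerr.rPlus (d.mass i) (d.spin i)) 0 + 1 ≤ R₀ + 4 := by linarith [hR₀ i]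
      _ ≤ R i τ := hR i τ
      _ ≤ max (R i τ) (Rg i τ) := hle i τ
  · -- certification at `R'`: the deviation at `max` of two radii is the `max` of the deviations
    have heq : (fun τ ↦ 𝓢.truncDeviationCk (d.background i) (d.chart i) 0 (max (R i τ) (Rg i τ)) τ) =
        fun τ ↦ max (𝓢.truncDeviationCk (d.background i) (d.chart i) 0 (R i τ) τ)
          (𝓢.truncDeviationCk (d.background i) (d.chart i) 0 (Rg i τ) τ) := by
      funext τ
      exact (hmono i τ).map_max
    rw [heq]
    simpa using (hcert i).max (hRg_lim i)
  · -- covering at `R'`: `certifiedLate`, `certifiedSlab` and `J⁻` are monotone in the radii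
    have hlate : certifiedLate d R τ₁ ⊆ certifiedLate d (fun i τ ↦ max (R i τ) (Rg i τ)) τ₁ := by
      refine union_subset_union_right _ (iUnion_mono fun i ↦ image_mono ?_)
      intro x hx
      exact ⟨hx.1, hx.2.trans (hle i _)⟩
    have hslab : certifiedSlab d R τ₁ ⊆ certifiedSlab d (fun i τ ↦ max (R i τ) (Rg i τ)) τ₁ :=
      union_subset_union_right _ (iUnion_mono fun i ↦
        image_mono ((d.background i).truncTimeSlab_mono (hle i τ₁) τ₁))
    have hJ : 𝓢.metric.causalPast 𝓢.timeOrientation (certifiedSlab d R τ₁) ⊆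
        𝓢.metric.causalPast 𝓢.timeOrientation
          (certifiedSlab d (fun i τ ↦ max (R i τ) (Rg i τ)) τ₁) :=
      LorentzianMetric.causalFuture_mono hslab
    intro p hp
    exact hJ (hcov τ₁ hτ₁ ⟨hp.1, fun h ↦ hp.2 (hlate h)⟩)

/-! ### The composition, concluding the crux BY NAME -/

/-- **`CensoredExteriorsSettle_of : X₁ → X₂ → GlobalAttraction.CensoredExteriorsSettle`** (kernel-checked,
placeholder-free): take X₁'s `(O, d, R₀)`; X₂ completes `d` into `d₂` on the same `O` (so `RaysStayInClosure 𝒟 O` is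
inherited and `O = exteriorOf 𝒟 d₂.charted`, `IsFutureOriented d₂` are X₂'s); the honest growing radii of
`HasExhaustiveCharts d₂` come from `hasExhaustiveCharts_of_covering₀`. [folklore] -/
theorem CensoredExteriorsSettle_of
    (h₁ : open Literature.Geometry.Lorentzian in open scoped ContDiff ENNReal Manifold Topology in let Hc := (fun (𝓢 : Spacetime.{0} 4) (O : Set 𝓢.carrier) (k : ℕ) (d : FinalStateDecomposition 𝓢 O k) (R₀ : ℝ) => let B := d.background; let t := fun i ↦ (B i).time; let r := fun i ↦ (B i).radius; let Ψ := d.chart; (∀ i, 100 * d.mass i ≤ R₀ ∧ 0 < ((d.motion i).1 : E4 ≃L[ℝ] E4) (E4.basisVector 0) 0) ∧ (∀ i (ϱ τ₂ : ℝ), R₀ ≤ ϱ → d.τ₀ < τ₂ → Ψ i '' {x | d.τ₀ < t i x.1 ∧ t i x.1 < τ₂ ∧ r i x.1 < ϱ} ⊆ 𝓢.metric.causalPast 𝓢.timeOrientation (Ψ i '' (B i).truncTimeSlab ϱ τ₂)) ∧ (∀ i (τ' : ℝ) (ϱ : ℝ → ℝ), Continuous ϱ → d.τ₀ < τ' → let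 A := Ψ i '' {x | τ' ≤ t i x.1 ∧ r i x.1 ≤ ϱ (t i x.1)}; closure A ∩ O ⊆ A) ∧ (∀ y : d.flatDomain, d.τ₀ < y.1 0 → 𝓢.timeOrientation.IsFutureDirected (mfderiv 𝓘(ℝ, E4) (𝓡 4) d.flatChart y (E4.basisVector 0)))); let Hf := (fun (𝓢 : Spacetime.{0} 4) (O : Set 𝓢.carrier) (k : ℕ) (d : FinalStateDecomposition 𝓢 O k) (R₀ : ℝ) => let B := d.background; let t := fun i ↦ (B i).time; let r := fun i ↦ (B i).radius; let Φ := d.flatChart; (∀ τ₂ : ℝ, d.τ₀ < τ₂ → Φ '' {y | d.τ₀ < y.1 0 ∧ y.1 0 < τ₂} ⊆ 𝓢.metric.causalPast 𝓢.timeOrientation (Φ '' (Minkowski.backgroundOn d.flatDomain).timeSlab τ₂)) ∧ (∀ τ' : ℝ, d.τ₀ < τ' → closure (Φ '' {y | τ' ≤ y.1 0 ∧ ∀ i, d.excision i (y.1 0) + 1 ≤ r i y.1}) ⊆ Φ '' {y | τ' ≤ y.1 0}) ∧ (∀ i, ∃ T : ℝ, supCkENorm (Subtype.val '' {x : (B i).domain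 | T ≤ t i x.1 ∧ R₀ ≤ r i x.1 ∧ ∀ j, j ≠ i → r i x.1 ≤ r j x.1}) 0 (𝓢.deviationExtend (B i) (d.chart i)) ≤ ENNReal.ofReal (1 / (10 * ‖(((d.motion i).1 : E4 ≃L[ℝ] E4) : E4 →L[ℝ] E4)‖ ^ 2)))); ∀ (X : Type) [TopologicalSpace X] [ChartedSpace E3 X] [IsManifold (𝓡 3) ((⊤ : ℕ∞) : WithTop ℕ∞) X] [T2Space X] [SecondCountableTopology X] [ConnectedSpace X], ∀ D ∈ admissibleVacuumData X, ∀ 𝒟 : VacuumCauchyDevelopment D, 𝒟.IsMaximal → Summit.FinalStateConjecture.HasCompleteNullInfinity 𝒟.toCauchyDevelopment → ∃ (O : Set 𝒟.carrier) (d : FinalStateDecomposition 𝒟.toSpacetime O 0) (R₀ : ℝ), O = Summit.FinalStateConjecture.exteriorOf 𝒟.toCauchyDevelopment d.charted ∧ Summit.FinalStateConjecture.RaysStayInClosure 𝒟.toCauchyDevelopment O ∧ Summit.FinalStateConjecture.IsFutureOriented d ∧ Hc 𝒟.toSpacetime O 0 d R₀ ∧ Hf 𝒟.toSpacetime O 0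 d R₀)
    (h₂ : open Literature.Geometry.Lorentzian in open scoped ContDiff ENNReal Manifold Topology in let Hc := (fun (𝓢 : Spacetime.{0} 4) (O : Set 𝓢.carrier) (k : ℕ) (d : FinalStateDecomposition 𝓢 O k) (R₀ : ℝ) => let B := d.background; let t := fun i ↦ (B i).time; let r := fun i ↦ (B i).radius; let Ψ := d.chart; (∀ i, 100 * d.mass i ≤ R₀ ∧ 0 < ((d.motion i).1 : E4 ≃L[ℝ] E4) (E4.basisVector 0) 0) ∧ (∀ i (ϱ τ₂ : ℝ), R₀ ≤ ϱ → d.τ₀ < τ₂ → Ψ i '' {x | d.τ₀ < t i x.1 ∧ t i x.1 < τ₂ ∧ r i x.1 < ϱ} ⊆ 𝓢.metric.causalPast 𝓢.timeOrientation (Ψ i '' (B i).truncTimeSlab ϱ τ₂)) ∧ (∀ i (τ' : ℝ) (ϱ : ℝ → ℝ), Continuous ϱ → d.τ₀ < τ' → let A := Ψ i '' {x | τ' ≤ t i x.1 ∧ r i x.1 ≤ ϱ (t i x.1)}; closure A ∩ O ⊆ A) ∧ (∀ y : d.flatDomain, d.τ₀ < y.1 0 → 𝓢.timeOrientation.IsFutureDirected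 (mfderiv 𝓘(ℝ, E4) (𝓡 4) d.flatChart y (E4.basisVector 0)))); let Hf := (fun (𝓢 : Spacetime.{0} 4) (O : Set 𝓢.carrier) (k : ℕ) (d : FinalStateDecomposition 𝓢 O k) (R₀ : ℝ) => let B := d.background; let t := fun i ↦ (B i).time; let r := fun i ↦ (B i).radius; let Φ := d.flatChart; (∀ τ₂ : ℝ, d.τ₀ < τ₂ → Φ '' {y | d.τ₀ < y.1 0 ∧ y.1 0 < τ₂} ⊆ 𝓢.metric.causalPast 𝓢.timeOrientation (Φ '' (Minkowski.backgroundOn d.flatDomain).timeSlab τ₂)) ∧ (∀ τ' : ℝ, d.τ₀ < τ' → closure (Φ '' {y | τ' ≤ y.1 0 ∧ ∀ i, d.excision i (y.1 0) + 1 ≤ r i y.1}) ⊆ Φ '' {y | τ' ≤ y.1 0}) ∧ (∀ i, ∃ T : ℝ, supCkENorm (Subtype.val '' {x : (B i).domain | T ≤ t i x.1 ∧ R₀ ≤ r i x.1 ∧ ∀ j, j ≠ i → r i x.1 ≤ r j x.1}) 0 (𝓢.deviationExtend (B i) (d.chart i)) ≤ ENNReal.ofReal (1 / (10 * ‖(((d.motion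 i).1 : E4 ≃L[ℝ] E4) : E4 →L[ℝ] E4)‖ ^ 2)))); let Tie := (fun (𝓢 : Spacetime.{0} 4) (O : Set 𝓢.carrier) (d d₂ : FinalStateDecomposition 𝓢 O 0) (R₀ : ℝ) => ∃ e : d.N = d₂.N, ∀ i : Fin d.N, d₂.mass (Fin.cast e i) = d.mass i ∧ d₂.spin (Fin.cast e i) = d.spin i ∧ d₂.motion (Fin.cast e i) = d.motion i ∧ ∀ x : (d.background i).domain, d₂.τ₀ < (d.background i).time x.1 → (d.background i).radius x.1 ≤ R₀ → ∃ y : (d₂.background (Fin.cast e i)).domain, y.1 = x.1 ∧ d₂.chart (Fin.cast e i) y = d.chart i x); ∀ (X : Type) [TopologicalSpace X] [ChartedSpace E3 X] [IsManifold (𝓡 3) ((⊤ : ℕ∞) : WithTop ℕ∞) X] [T2Space X] [SecondCountableTopology X] [ConnectedSpace X], ∀ D ∈ admissibleVacuumData X, ∀ 𝒟 : VacuumCauchyDevelopment D, 𝒟.IsMaximal → Summit.FinalStateConjecture.HasCompleteNullInfinity 𝒟.toCauchyDevelopment → ∀ (O : Set 𝒟.carrier) (d : FinalStateDecomposition 𝒟.toSpacetime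 O 0) (R₀ : ℝ), O = Summit.FinalStateConjecture.exteriorOf 𝒟.toCauchyDevelopment d.charted → Summit.FinalStateConjecture.RaysStayInClosure 𝒟.toCauchyDevelopment O → Summit.FinalStateConjecture.IsFutureOriented d → Hc 𝒟.toSpacetime O 0 d R₀ → Hf 𝒟.toSpacetime O 0 d R₀ → ∃ (d₂ : FinalStateDecomposition 𝒟.toSpacetime O 0) (R : Fin d₂.N → ℝ → ℝ) (R₀' : ℝ), O = Summit.FinalStateConjecture.exteriorOf 𝒟.toCauchyDevelopment d₂.charted ∧ Summit.FinalStateConjecture.IsFutureOriented d₂ ∧ R₀ ≤ R₀' ∧ (∀ i, 100 * d₂.mass i ≤ R₀') ∧ (∀ i s, R₀' + 4 ≤ R i s) ∧ (∀ i, Filter.Tendsto (fun τ ↦ 𝒟.toSpacetime.truncDeviationCk (d₂.background i) (d₂.chart i) 0 (R i τ) τ) Filter.atTop (nhds 0)) ∧ (∀ τ₁ : ℝ, d₂.τ₀ < τ₁ → O \ Summit.FinalStateConjecture.certifiedLate d₂ R τ₁ ⊆ 𝒟.toSpacetime.metric.causalPast 𝒟.toSpacetime.timeOrientation (Summit.FinalStateConjecture.certifiedSlab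 d₂ R τ₁)) ∧ Tie 𝒟.toSpacetime O d d₂ R₀) :
    Summit.FinalStateConjecture.FinalStateConjecture.Theses.GlobalAttraction.CensoredExteriorsSettle := by
  intro X _ _ _ _ _ _ D hD 𝒟 hmax hscri
  obtain ⟨O, d, R₀, hO, hRay, hFut, hc, hf⟩ := h₁ X D hD 𝒟 hmax hscri
  obtain ⟨d₂, R, R₀', hO₂, hFut₂, -, hM, hR, hcert, hcov, -⟩ :=
    h₂ X D hD 𝒟 hmax hscri O d R₀ hO hRay hFut hc hf
  exact ⟨O, d₂, hO₂, hRay, hasExhaustiveCharts_of_covering₀ d₂ R R₀' hM hR hcert hcov, hFut₂⟩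

/-- The composition instantiated on the stubs (sorries ONLY inside `stub_*`). -/
theorem censoredExteriorsSettle_holds_of_stubs :
    Summit.FinalStateConjecture.FinalStateConjecture.Theses.GlobalAttraction.CensoredExteriorsSettle :=
  CensoredExteriorsSettle_of stub_censoredFixedRadiusSettle stub_fixedRadiusNecksComplete

end Summit.FinalStateConjecture.FinalStateConjecture.Cruxes.CensoredExteriorsSettle.NeckSplit

end
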